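import Summits.KontsevichZagierPeriods.Statement
import Summits.KontsevichZagierPeriods.KontsevichZagierPeriods.Theses.VietaFibre
import Summits.KontsevichZagierPeriods.KontsevichZagierPeriods.Theses.OctahedralSymmetry
import Literature.NumberTheory.Transcendental.KZKernelConjectureForms
import HarnessLib

/-!
# Crux `KernelForm` (stmt-KontsevichZagierPeriods-10447), line `Sketch`: the crux IS the summit

The shared crux `KernelForm` of routes VietaFibre / OctahedralSymmetry is, as a term, the definiens of
the tree's named conjecture `Literature.NumberTheory.Transcendental.KZKernelConjecture` (Conjecture 1
of Kontsevich–Zagier in kernel form, `ker KZ.eval = KZ.relations`, tagged `@[conjecture]` in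
`PeriodConjecture.lean`), and that conjecture is equivalent to the summit statement
`KontsevichZagierPeriods` (`kzKernelConjecture_iff_isRational`, `KZKernelConjectureForms.lean`).
This file records both facts as importable theorems on the Theorems side, attached to the item, so
that "proving stmt-10447 = proving the summit" is citable by name:

* `kernelForm_iff_kzKernelConjecture` — `VietaFibre.KernelForm ↔ KZKernelConjecture` (`Iff.rfl`);
* `kernelForm_iff_summit` — `VietaFibre.KernelForm ↔ KontsevichZagierPeriods`;
* the twins for route OctahedralSymmetry's (definitionally equal) name of the crux.

Together with the line's cut (`VietaFibreKernelFormCut.lean`: `KernelForm ↔ WeakKernel ∧ Cancellation`)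
and item dictionary (`VietaFibreKernelFormItemDictionary.lean`:
`KernelForm ↔ AyoubPiLocalKernel (stmt-0541) ∧ PositiveCancellation (stmt-5621)`,
`KernelForm ↔ RationalKernel (stmt-3165)`), this is the complete status of the crux: it is the open
problem itself, decided by items 0541 ∧ 5621. Source: M. Kontsevich, D. Zagier, *Periods* (2001),
§1.2 Conjecture 1.
-/

open Literature.NumberTheory.Transcendental

namespace Summit.KontsevichZagierPeriods.KernelForm.LocaliseAtValuePrime

/-- The crux `VietaFibre.KernelForm` (stmt-KontsevichZagierPeriods-10447) is verbatim the named
conjecture `KZKernelConjecture` (Kontsevich–Zagier Conjecture 1, kernel form). [folklore] -/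
theorem kernelForm_iff_kzKernelConjecture :
    Summit.KontsevichZagierPeriods.KontsevichZagierPeriods.Theses.VietaFibre.KernelForm ↔
      KZKernelConjecture :=
  Iff.rfl

/-- **The crux is the summit**: `VietaFibre.KernelForm ↔ KontsevichZagierPeriods` (the kernel form
`ker eval = relations` versus the two-representation form of Conjecture 1 over rational integrands,
via `kzKernelConjecture_iff_isRational`). [folklore] -/
theorem kernelForm_iff_summit :
    Summit.KontsevichZagierPeriods.KontsevichZagierPeriods.Theses.VietaFibre.KernelForm ↔
      KontsevichZagierPeriods :=
  kzKernelConjecture_iff_isRational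

/-- Route OctahedralSymmetry's name of the crux is verbatim `KZKernelConjecture`. [folklore] -/
theorem octahedralSymmetry_kernelForm_iff_kzKernelConjecture :
    Summit.KontsevichZagierPeriods.KontsevichZagierPeriods.Theses.OctahedralSymmetry.KernelForm ↔
      KZKernelConjecture :=
  Iff.rfl

/-- Route OctahedralSymmetry's name of the crux is equivalent to the summit. [folklore] -/
theorem octahedralSymmetry_kernelForm_iff_summit :
    Summit.KontsevichZagierPeriods.KontsevichZagierPeriods.Theses.OctahedralSymmetry.KernelForm ↔
      KontsevichZagierPeriods :=
  kzKernelConjecture_iff_isRational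

end Summit.KontsevichZagierPeriods.KernelForm.LocaliseAtValuePrime
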